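import Mathlib
import Summits.Ventures.PercRepro2.SeriesSplit
import Summits.Ventures.PercRepro2.StrandSum

/-!
# Series composition for row B2: `F = min(F₁, F₂)` and the product of log-concave tails
(seat mine-b, cell pub-perc-repro2)

With the splitting lemmas of `SeriesSplit.lean`: for parts `E₁`, `E₂` sharing only the cut vertex
`v`, with `s` touched only by `E₁` and `t` only by `E₂`, the flow of the union is the minimum of
the two flows, `{F ≥ k} = {F₁ ≥ k} ∩ {F₂ ≥ k}` (`flowIn_union_iff_series`), hence
`P(F ≥ k) = P(F₁ ≥ k)·P(F₂ ≥ k)` by independence of disjoint edge sets (`prob_flowIn_series`),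
the flow tail of the composition is the pointwise product of the tails (`flowTail_series`), and
log-concave tails are closed under pointwise products (`IFR.mul_isLCTail`): **row B2 for a series
composition follows from row B2 for the two parts** (`isLCTail_flowTail_series`,
`flow_logconcave_of_series`).  `StrandMany.lean` is the parallel counterpart; `LCNet.lean` puts the
two together.
-/

open Finset

namespace Summit.Ventures.PercRepro2

open IFR

variable {V : Type*} {E : Type*} [Fintype E] [DecidableEq E]

/-- **series composition**: the union carries `k` disjoint `s–t` paths iff `E₁` carries `k` disjoint
`s–v` paths and `E₂` carries `k` disjoint `v–t` paths -/
theorem flowIn_union_iff_series {ends : E → Sym2 V} {s v t : V} {E₁ E₂ : Finset E}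
    (hE : SharesOnlyVertex ends v E₁ E₂) (hs : ∀ e ∈ E₂, s ∉ ends e) (ht : ∀ e ∈ E₁, t ∉ ends e)
    (hsv : s ≠ v) (htv : t ≠ v) (hst : s ≠ t) (hdisj : Disjoint E₁ E₂) (k : ℕ) (ω : Config E) :
    ω ∈ flowIn ends s t (E₁ ∪ E₂) k ↔ ω ∈ flowIn ends s v E₁ k ∧ ω ∈ flowIn ends v t E₂ k := by
  have h1 : openSet ω ∩ (E₁ ∪ E₂) ∩ E₁ = openSet ω ∩ E₁ := by
    ext e; simp only [Finset.mem_inter, Finset.mem_union]; tauto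
  have h2 : openSet ω ∩ (E₁ ∪ E₂) ∩ E₂ = openSet ω ∩ E₂ := by
    ext e; simp only [Finset.mem_inter, Finset.mem_union]; tauto
  constructor
  · intro h
    obtain ⟨hA, hB⟩ := kDisj_series_split hE hs ht hsv htv hst k Finset.inter_subset_right h
    rw [h1] at hA; rw [h2] at hB
    exact ⟨hA, hB⟩
  · rintro ⟨hA, hB⟩
    have hd : Disjoint (openSet ω ∩ E₁) (openSet ω ∩ E₂) :=
      Finset.disjoint_of_subset_left Finset.inter_subset_right
        (Finset.disjoint_of_subset_right Finset.inter_subset_right hdisj)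
    have hm := kDisj_series_merge k hd hA hB
    have hu : openSet ω ∩ E₁ ∪ openSet ω ∩ E₂ = openSet ω ∩ (E₁ ∪ E₂) := by
      rw [← Finset.inter_union_distrib_left]
    rw [hu] at hm
    exact hm

/-- the event `F ≥ k` of a series composition is the intersection of the two part events -/
theorem flowIn_union_eq_inter_series {ends : E → Sym2 V} {s v t : V} {E₁ E₂ : Finset E}
    (hE : SharesOnlyVertex ends v E₁ E₂) (hs : ∀ e ∈ E₂, s ∉ ends e) (ht : ∀ e ∈ E₁, t ∉ ends e)
    (hsv : s ≠ v) (htv : t ≠ v) (hst : s ≠ t) (hdisj : Disjoint E₁ E₂) (k : ℕ) :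
    flowIn ends s t (E₁ ∪ E₂) k = flowIn ends s v E₁ k ∩ flowIn ends v t E₂ k := by
  ext ω
  exact flowIn_union_iff_series hE hs ht hsv htv hst hdisj k ω

/-- **`P(F ≥ k) = P(F₁ ≥ k)·P(F₂ ≥ k)` for a series composition** (independence of the parts) -/
theorem prob_flowIn_series (p : E → ℝ) {ends : E → Sym2 V} {s v t : V} {E₁ E₂ : Finset E}
    (hE : SharesOnlyVertex ends v E₁ E₂) (hs : ∀ e ∈ E₂, s ∉ ends e) (ht : ∀ e ∈ E₁, t ∉ ends e)
    (hsv : s ≠ v) (htv : t ≠ v) (hst : s ≠ t) (hdisj : Disjoint E₁ E₂) (k : ℕ) :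
    prob p (flowIn ends s t (E₁ ∪ E₂) k) = prob p (flowIn ends s v E₁ k) * prob p (flowIn ends v t E₂ k) := by
  rw [flowIn_union_eq_inter_series hE hs ht hsv htv hst hdisj k]
  exact prob_inter_eq_mul_of_dependsOn p (Finset.disjoint_coe.2 hdisj)
    (dependsOn_flowIn ends s v E₁ k) (dependsOn_flowIn ends v t E₂ k)

/-- the flow tail of a series composition is the pointwise product of the tails of the parts -/
theorem flowTail_series (p : E → ℝ) {ends : E → Sym2 V} {s v t : V} {E₁ E₂ : Finset E}
    (hE : SharesOnlyVertex ends v E₁ E₂) (hs : ∀ e ∈ E₂, s ∉ ends e) (ht : ∀ e ∈ E₁, t ∉ ends e)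
    (hsv : s ≠ v) (htv : t ≠ v) (hst : s ≠ t) (hdisj : Disjoint E₁ E₂) :
    flowTail p ends s t (E₁ ∪ E₂) = fun k => flowTail p ends s v E₁ k * flowTail p ends v t E₂ k := by
  funext k
  rcases le_or_gt k 0 with hk | hk
  · rw [flowTail_of_nonpos _ _ _ _ _ hk, flowTail_of_nonpos _ _ _ _ _ hk, flowTail_of_nonpos _ _ _ _ _ hk]
    ring
  · rw [flowTail_of_pos _ _ _ _ _ hk, flowTail_of_pos _ _ _ _ _ hk, flowTail_of_pos _ _ _ _ _ hk,
      prob_flowIn_series p hE hs ht hsv htv hst hdisj]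

/-- **series composition of log-concave flow tails** -/
theorem isLCTail_flowTail_series (p : E → ℝ) {ends : E → Sym2 V} {s v t : V} {E₁ E₂ : Finset E}
    (hE : SharesOnlyVertex ends v E₁ E₂) (hs : ∀ e ∈ E₂, s ∉ ends e) (ht : ∀ e ∈ E₁, t ∉ ends e)
    (hsv : s ≠ v) (htv : t ≠ v) (hst : s ≠ t) (hdisj : Disjoint E₁ E₂)
    (h₁ : IsLCTail (flowTail p ends s v E₁) ((E₁.card : ℤ) + 1))
    (h₂ : IsLCTail (flowTail p ends v t E₂) ((E₂.card : ℤ) + 1)) :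
    IsLCTail (flowTail p ends s t (E₁ ∪ E₂)) (min ((E₁.card : ℤ) + 1) ((E₂.card : ℤ) + 1)) := by
  rw [flowTail_series p hE hs ht hsv htv hst hdisj]
  exact mul_isLCTail h₁ h₂

/-- a log-concave tail with support bound `N` is one with any larger bound -/
theorem IFR.IsLCTail.of_le {F : ℤ → ℝ} {N N' : ℤ} (h : IsLCTail F N) (hN : N ≤ N') : IsLCTail F N' :=
  ⟨h.one, h.nonneg, h.anti, h.lc, fun k hk => h.vanish k (le_trans hN hk)⟩

/-- the series composition with the canonical support bound `|E₁ ∪ E₂| + 1` -/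
theorem isLCTail_flowTail_series' (p : E → ℝ) {ends : E → Sym2 V} {s v t : V} {E₁ E₂ : Finset E}
    (hE : SharesOnlyVertex ends v E₁ E₂) (hs : ∀ e ∈ E₂, s ∉ ends e) (ht : ∀ e ∈ E₁, t ∉ ends e)
    (hsv : s ≠ v) (htv : t ≠ v) (hst : s ≠ t) (hdisj : Disjoint E₁ E₂)
    (h₁ : IsLCTail (flowTail p ends s v E₁) ((E₁.card : ℤ) + 1))
    (h₂ : IsLCTail (flowTail p ends v t E₂) ((E₂.card : ℤ) + 1)) :
    IsLCTail (flowTail p ends s t (E₁ ∪ E₂)) (((E₁ ∪ E₂).card : ℤ) + 1) := by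
  refine (isLCTail_flowTail_series p hE hs ht hsv htv hst hdisj h₁ h₂).of_le ?_
  have h := Finset.card_le_card (Finset.subset_union_left (s₁ := E₁) (s₂ := E₂))
  have h' := Finset.card_le_card (Finset.subset_union_right (s₁ := E₁) (s₂ := E₂))
  rw [min_le_iff]
  left
  omega

/-- **row B2 for a series composition whose parts satisfy it**: with `E = E₁ ⊔ E₂` sharing only
the cut vertex `v`, `s` only in `E₁`, `t` only in `E₂`,
`P(F ≥ k)·P(F ≥ k+2) ≤ P(F ≥ k+1)²` for every product measure. -/
theorem flow_logconcave_of_series {p : E → ℝ} (hp : IsProbVec p) {ends : E → Sym2 V} {s v t : V}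
    {E₁ E₂ : Finset E}
    (hE : SharesOnlyVertex ends v E₁ E₂) (hs : ∀ e ∈ E₂, s ∉ ends e) (ht : ∀ e ∈ E₁, t ∉ ends e)
    (hsv : s ≠ v) (htv : t ≠ v) (hst : s ≠ t) (hdisj : Disjoint E₁ E₂) (hcov : E₁ ∪ E₂ = Finset.univ)
    (hlc₁ : ∀ k : ℕ, prob p (flowIn ends s v E₁ k) * prob p (flowIn ends s v E₁ (k + 2))
      ≤ prob p (flowIn ends s v E₁ (k + 1)) * prob p (flowIn ends s v E₁ (k + 1)))
    (hlc₂ : ∀ k : ℕ, prob p (flowIn ends v t E₂ k) * prob p (flowIn ends v t E₂ (k + 2))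
      ≤ prob p (flowIn ends v t E₂ (k + 1)) * prob p (flowIn ends v t E₂ (k + 1)))
    (k : ℕ) :
    prob p (flowEvent ends s t k) * prob p (flowEvent ends s t (k + 2))
      ≤ prob p (flowEvent ends s t (k + 1)) * prob p (flowEvent ends s t (k + 1)) := by
  have h := isLCTail_flowTail_series p hE hs ht hsv htv hst hdisj
    (isLCTail_flowTail hp hsv E₁ hlc₁) (isLCTail_flowTail hp htv.symm E₂ hlc₂)
  rw [hcov] at h
  have hk := h.lc ((k : ℤ) + 1)
  have e1 : ((k : ℤ) + 1 - 1) = (k : ℤ) := by ring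
  have e2 : ((k : ℤ) + 1 + 1) = ((k + 2 : ℕ) : ℤ) := by push_cast; ring
  have e3 : ((k : ℤ) + 1) = ((k + 1 : ℕ) : ℤ) := by push_cast; ring
  rw [e1, e2, e3, flowTail_natCast, flowTail_natCast, flowTail_natCast, flowIn_univ, flowIn_univ,
    flowIn_univ] at hk
  exact hk

end Summit.Ventures.PercRepro2
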